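import Summits.QuantumFields.QCD.Theorems.QuarksAsStableActionCriticalLineDiamagnetismMixedSchwarzDet
import Summits.QuantumFields.QCD.Theorems.QuarksAsStableActionCriticalLineDiamagnetismClosedSlabPackaging
import Summits.QuantumFields.QCD.Theorems.QuarksAsStableActionCriticalLineDiamagnetismEvenCycleChessboard

/-!
# Route B abstract chain, `+` half (helper `routeBPlusChain` of stub `routeBAlgebra`, line `Sketch`)
(crux `Summit.QuantumFields.QCD.Theses.QuarksAsStableAction.CriticalLineDiamagnetism`, item stmt-QuantumFields-9734,
static route for odd tori, stub `stub_heavyFrequencyGain`, Route B = reflection positivity in frequency land)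

For positive definite one-step matrices `M_i` and unitary transporters `W_i` on the odd cycle `ZMod (2n+1)`
(`n ≥ 1`), the `+` reflected word `word₊` of the mixed Schwarz inequality `mixedSchwarzDet` obeys
`‖det (1 + word₊)‖ ^ n ≤ (∏ᵢ max(μᵢ(M_n), 1)) ^ n · ∏_{t<n} Re det (1 + (W_tᴴ M_t W_t M_{t+1})^n)`.

Proof (composition of tree facts):
* `det (1 + word₊)` is a non-negative real (`(1 + word₊) M_0 = M_0 + (X M_n)(X M_n)ᴴ`, `X = ∏_{i<n} M_i W_i`),
  so its norm is its real part (`norm_det_one_add_wordPlus`);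
* closed-slab packaging `closedSlabPackaging` (B1′ + defect removal B3):
  `Re det (1 + word₊) ≤ (∏ max(μᵢ(M_n),1)) · Re det (1 + Y Yᴴ)`, `Y = T_0 ⋯ T_{n-1}`, `T_t = A_tᴴ W_t A_{t+1}`, and
  `det (1 + (T_tᴴ T_t)^n) = det (1 + (W_tᴴ M_t W_t M_{t+1})^n)`;
* the even-cycle chessboard estimate `evenCycleChessboard` (B4) on the fermionic FOCK space for the `2n` letters
  `Γ(T_0), …, Γ(T_{n-1}), Γ(T_{n-1})ᴴ, …, Γ(T_0)ᴴ` (`Γ = fockLift`, `Γ(XY) = Γ(X)Γ(Y)`, `Γ(Xᴴ) = Γ(X)ᴴ`,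
  `Tr Γ(X) = det (1 + X)`): `det (1 + Y Yᴴ)^{2n} ≤ ∏_{t<n} det (1 + (T_tᴴ T_t)^n)²`, i.e.
  `(Re det (1 + Y Yᴴ))^n ≤ ∏_{t<n} Re det (1 + (T_tᴴ T_t)^n)` (`fock_chessboard`; all factors are `≥ 1`).
Pure theorem file (no definitions).
-/

namespace Summit.QuantumFields.QCD.Cruxes.CriticalLineDiamagnetism.ChessboardCellGain

open Matrix
open scoped ComplexOrder MatrixOrder
open Literature.MathematicalPhysics.QuantumFieldTheory (fockLift)
open Summit.QuantumFields.QCD.Cruxes.StableActionBridge.Sketch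
open Summit.QuantumFields.QCD.Cruxes.WilsonQuarkStability.FreeTangentLandauChessboard
open Summit.QuantumFields.QCD.Theorems (BackgroundSchwarz.one_le_det_one_add)

namespace RouteBAlgebra

/-- Regrouping of an alternating product: `(∏_{i<m} aᵢ bᵢ) · aₘ = a₀ · ∏_{i<m} (bᵢ aᵢ₊₁)`. -/
theorem prod_range_regroup {α : Type} [Monoid α] (a b : ℕ → α) (m : ℕ) :
    ((List.range m).map fun i => a i * b i).prod * a m =
      a 0 * ((List.range m).map fun i => b i * a (i + 1)).prod := by
  induction m with
  | zero => simp
  | succ m ih =>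
    rw [List.prod_range_succ, List.prod_range_succ, ← mul_assoc (a 0), ← ih]
    simp only [mul_assoc]

/-- Expansion of the `+` reflected word on `ZMod (2n+1)`:
`word₊ = (∏_{i<n} M_i W_i) · (M_n · ∏_{j<n} M_{n-j} W_{n-1-j}ᴴ)` (as in the closed-slab packaging file). -/
theorem wordPlus_expand {k : Type} [Fintype k] [DecidableEq k] (n : ℕ)
    (M W : ZMod (2 * n + 1) → Matrix k k ℂ) :
    ((List.range (2 * n + 1)).map fun i : ℕ =>
        M ((fun j : ZMod (2 * n + 1) => if j.val ≤ n then j else -j) (i : ZMod (2 * n + 1))) *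
          (fun j : ZMod (2 * n + 1) => if j.val < n then W j else if j.val = n then 1 else (W (-1 - j))ᴴ)
            (i : ZMod (2 * n + 1))).prod =
      ((List.range n).map fun i : ℕ => M i * W i).prod *
        (M n * ((List.range n).map fun j : ℕ =>
          M ((n - j : ℕ) : ZMod (2 * n + 1)) * (W ((n - 1 - j : ℕ) : ZMod (2 * n + 1)))ᴴ).prod) := by
  have hsplit : List.range (2 * n + 1) =
      List.range n ++ (n :: (List.range n).map (fun j => n + (j + 1))) := by
    rw [show 2 * n + 1 = n + (n + 1) by ring, List.range_add, List.range_succ_eq_map, List.map_cons,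
      List.map_map]
    rfl
  have hval : ∀ i : ℕ, i < 2 * n + 1 → ((i : ZMod (2 * n + 1))).val = i :=
    fun i hi => ZMod.val_cast_of_lt hi
  rw [hsplit, List.map_append, List.map_cons, List.prod_append, List.prod_cons, List.map_map]
  congr 1
  · apply congrArg List.prod
    apply List.map_congr_left
    intro i hi
    rw [List.mem_range] at hi
    simp only [hval i (by omega), hi.le, hi, if_true]
  · congr 1
    · simp only [hval n (by omega), le_refl, lt_irrefl, if_true, if_false, Matrix.mul_one]
    · apply congrArg List.prod
      apply List.map_congr_left
      intro j hj
      rw [List.mem_range] at hj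
      have h1 : ¬ (n + (j + 1) ≤ n) := by omega
      have h2 : ¬ (n + (j + 1) < n) := by omega
      have h3 : n + (j + 1) ≠ n := by omega
      simp only [Function.comp_apply, hval (n + (j + 1)) (by omega), h1, h2, h3, if_false]
      have e1 : (-((n + (j + 1) : ℕ) : ZMod (2 * n + 1))) = ((n - j : ℕ) : ZMod (2 * n + 1)) := by
        apply neg_eq_of_add_eq_zero_right
        rw [← Nat.cast_add, show n + (j + 1) + (n - j) = 2 * n + 1 by omega, ZMod.natCast_self]
      have e2 : (-1 - ((n + (j + 1) : ℕ) : ZMod (2 * n + 1))) = ((n - 1 - j : ℕ) : ZMod (2 * n + 1)) := by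
        rw [← neg_add']
        apply neg_eq_of_add_eq_zero_right
        rw [show (1 : ZMod (2 * n + 1)) = ((1 : ℕ) : ZMod (2 * n + 1)) from Nat.cast_one.symm,
          ← Nat.cast_add, ← Nat.cast_add, show 1 + (n + (j + 1)) + (n - 1 - j) = 2 * n + 1 by omega,
          ZMod.natCast_self]
      rw [e1, e2]

/-- The mirrored tail of `word₊` against `M_0` is `M_n` times the adjoint of the head:
`(∏_{j<n} M_{n-j} W_{n-1-j}ᴴ) · M_0 = M_n · (∏_{i<n} M_i W_i)ᴴ` (Hermitian `M`). -/
theorem tail_mul_eq {k : Type} [Fintype k] [DecidableEq k] (n : ℕ)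
    (M W : ZMod (2 * n + 1) → Matrix k k ℂ) (hH : ∀ i, (M i)ᴴ = M i) :
    ((List.range n).map fun j : ℕ =>
        M ((n - j : ℕ) : ZMod (2 * n + 1)) * (W ((n - 1 - j : ℕ) : ZMod (2 * n + 1)))ᴴ).prod *
        M ((n - n : ℕ) : ZMod (2 * n + 1)) =
      M ((n - 0 : ℕ) : ZMod (2 * n + 1)) * (((List.range n).map fun i : ℕ => M i * W i).prod)ᴴ := by
  rw [reflectionStep_conjTranspose_prod_range_map,
    prod_range_regroup (fun j : ℕ => M ((n - j : ℕ) : ZMod (2 * n + 1)))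
      (fun j : ℕ => (W ((n - 1 - j : ℕ) : ZMod (2 * n + 1)))ᴴ) n]
  congr 1
  refine congrArg List.prod (List.map_congr_left fun t _ => ?_)
  simp only [conjTranspose_mul, hH, show n - (t + 1) = n - 1 - t by omega]

/-- In `ℂ` with its star order: if `z · d₀ = d₁` with `0 < d₀` and `0 ≤ d₁` then `0 ≤ z`. -/
theorem nonneg_of_mul_eq {z d₀ d₁ : ℂ} (h : z * d₀ = d₁) (h0 : 0 < d₀) (h1 : 0 ≤ d₁) : 0 ≤ z := by
  obtain ⟨hre0, him0⟩ := Complex.lt_def.1 h0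
  obtain ⟨hre1, him1⟩ := Complex.le_def.1 h1
  have hr := congrArg Complex.re h
  have hi := congrArg Complex.im h
  simp only [Complex.mul_re, Complex.mul_im, Complex.zero_re, Complex.zero_im] at hr hi hre0 him0 hre1 him1
  rw [← him0, mul_zero, sub_zero] at hr
  rw [← him0, mul_zero, zero_add, ← him1] at hi
  have hzim : z.im = 0 := by
    rcases mul_eq_zero.1 hi with h' | h'
    · exact h'
    · exact absurd h' hre0.ne'
  refine Complex.le_def.2 ⟨?_, ?_⟩
  · rw [Complex.zero_re]
    by_contra hneg
    rw [not_le] at hneg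
    have : z.re * d₀.re < 0 := mul_neg_of_neg_of_pos hneg hre0
    linarith
  · rw [Complex.zero_im, hzim]

/-- `det (1 + word₊)` is a non-negative real number, so its norm is its real part:
`(1 + word₊) M_0 = M_0 + (X M_n)(X M_n)ᴴ` with `X = ∏_{i<n} M_i W_i` is positive definite. -/
theorem norm_det_one_add_wordPlus {k : Type} [Fintype k] [DecidableEq k] (n : ℕ)
    (M W : ZMod (2 * n + 1) → Matrix k k ℂ) (hM : ∀ i, (M i).PosDef) :
    ‖(1 + ((List.range (2 * n + 1)).map fun i : ℕ =>
        M ((fun j : ZMod (2 * n + 1) => if j.val ≤ n then j else -j) (i : ZMod (2 * n + 1))) *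
          (fun j : ZMod (2 * n + 1) => if j.val < n then W j else if j.val = n then 1 else (W (-1 - j))ᴴ)
            (i : ZMod (2 * n + 1))).prod).det‖ =
      ((1 + ((List.range (2 * n + 1)).map fun i : ℕ =>
        M ((fun j : ZMod (2 * n + 1) => if j.val ≤ n then j else -j) (i : ZMod (2 * n + 1))) *
          (fun j : ZMod (2 * n + 1) => if j.val < n then W j else if j.val = n then 1 else (W (-1 - j))ᴴ)
            (i : ZMod (2 * n + 1))).prod).det).re := by
  suffices h : 0 ≤ (1 + ((List.range (2 * n + 1)).map fun i : ℕ =>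
        M ((fun j : ZMod (2 * n + 1) => if j.val ≤ n then j else -j) (i : ZMod (2 * n + 1))) *
          (fun j : ZMod (2 * n + 1) => if j.val < n then W j else if j.val = n then 1 else (W (-1 - j))ᴴ)
            (i : ZMod (2 * n + 1))).prod).det by
    have h' := congrArg Complex.re (Complex.norm_of_nonneg' h)
    rwa [Complex.ofReal_re] at h'
  rw [wordPlus_expand]
  have hT := tail_mul_eq n M W fun i => (hM i).1.eq
  simp only [Nat.sub_self, Nat.sub_zero, Nat.cast_zero] at hT
  set X := ((List.range n).map fun i : ℕ => M i * W i).prod with hX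
  set T := ((List.range n).map fun j : ℕ =>
    M ((n - j : ℕ) : ZMod (2 * n + 1)) * (W ((n - 1 - j : ℕ) : ZMod (2 * n + 1)))ᴴ).prod with hTdef
  have hkey : (1 + X * (M n * T)) * M 0 = M 0 + (X * M n) * (X * M n)ᴴ := by
    rw [Matrix.add_mul, Matrix.one_mul, conjTranspose_mul, (hM n).1.eq]
    simp only [Matrix.mul_assoc]
    rw [hT]
  have hpos : (M 0 + (X * M n) * (X * M n)ᴴ).PosDef :=
    (hM 0).add_posSemidef (posSemidef_self_mul_conjTranspose _)
  have hdet : (1 + X * (M n * T)).det * (M 0).det = (M 0 + (X * M n) * (X * M n)ᴴ).det := by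
    rw [← det_mul, hkey]
  exact nonneg_of_mul_eq hdet (hM 0).det_pos hpos.det_pos.le

/-- Sylvester's determinant identity for powers: `det (1 + (A B)^p) = det (1 + (B A)^p)`. -/
theorem det_one_add_pow_comm {k : Type} [Fintype k] [DecidableEq k]
    (A B : Matrix k k ℂ) (p : ℕ) :
    (1 + (A * B) ^ p).det = (1 + (B * A) ^ p).det := by
  cases p with
  | zero => simp
  | succ q =>
    rw [pow_succ (A * B) q, ← Matrix.mul_assoc ((A * B) ^ q) A B, mul_pow_mul A B q,
      Matrix.mul_assoc A ((B * A) ^ q) B, Matrix.det_one_add_mul_comm A ((B * A) ^ q * B),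
      Matrix.mul_assoc ((B * A) ^ q) B A, ← pow_succ]

/-- For `P ⪰ 0`, `det (1 + P)` is a real number `≥ 1`: its norm is its real part, which is `≥ 1`. -/
theorem norm_det_one_add_psd {m : Type} [Fintype m] [DecidableEq m] {P : Matrix m m ℂ}
    (hP : P.PosSemidef) : ‖(1 + P).det‖ = ((1 + P).det).re ∧ 1 ≤ ((1 + P).det).re := by
  have h1 : (1 : ℂ) ≤ (1 + P).det := BackgroundSchwarz.one_le_det_one_add hP
  obtain ⟨hre, -⟩ := Complex.le_def.1 h1
  refine ⟨?_, by simpa using hre⟩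
  have h := congrArg Complex.re (Complex.norm_of_nonneg' (zero_le_one.trans h1))
  rwa [Complex.ofReal_re] at h

/-- **The even-cycle chessboard estimate on Fock space.** For matrices `T_0, …, T_{n-1}` (`n ≥ 1`) and
`Y = T_0 ⋯ T_{n-1}`: `(Re det (1 + Y Yᴴ))^n ≤ ∏_{t<n} Re det (1 + (T_tᴴ T_t)^n)` — the chessboard estimate
`evenCycleChessboard` for the `2n` letters `Γ(T_0), …, Γ(T_{n-1}), Γ(T_{n-1})ᴴ, …, Γ(T_0)ᴴ`, read through
`Tr Γ(X) = det (1 + X)` and Sylvester. -/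
theorem fock_chessboard {k : Type} [Fintype k] [DecidableEq k] (n : ℕ) (hn : 0 < n)
    (T : ℕ → Matrix k k ℂ) :
    ((1 + ((List.range n).map T).prod * (((List.range n).map T).prod)ᴴ).det).re ^ n ≤
      ∏ t ∈ Finset.range n, ((1 + ((T t)ᴴ * T t) ^ n).det).re := by
  -- a linear order on `k` (to enumerate Fock states), with the ambient decidable equality
  letI lo : LinearOrder k :=
    { le := fun a b => Fintype.equivFin k a ≤ Fintype.equivFin k b
      le_refl := fun a => le_refl _
      le_trans := fun a b c => le_trans
      le_antisymm := fun a b h1 h2 => (Fintype.equivFin k).injective (le_antisymm h1 h2)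
      le_total := fun a b => le_total _ _
      toDecidableLE := fun a b => inferInstanceAs (Decidable (Fintype.equivFin k a ≤ Fintype.equivFin k b))
      toDecidableEq := inferInstance }
  -- the `2n` letters on Fock space
  set X : ℕ → Matrix (Finset k) (Finset k) ℂ := fun i => fockLift (T i) with hX
  set B' : ℕ → Matrix (Finset k) (Finset k) ℂ :=
    fun i => if i < n then X i else (X (2 * n - 1 - i))ᴴ with hB'
  have key := evenCycleChessboard n hn (fun j : Fin (2 * n) => B' j)
  beta_reduce at key
  -- the word is `Γ(Y) Γ(Y)ᴴ`, of trace `det (1 + Y Yᴴ)`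
  set Y := ((List.range n).map T).prod with hY
  have hsplit : ∀ f : ℕ → Matrix (Finset k) (Finset k) ℂ, ((List.range (2 * n)).map f).prod =
      ((List.range n).map f).prod * ((List.range n).map fun t => f (n + t)).prod := by
    intro f
    rw [two_mul, List.range_add, List.map_append, List.prod_append, List.map_map]
    rfl
  have hP : ((List.range n).map X).prod = fockLift Y := by
    rw [hY, StaticSliceBound.fockLift_list_prod, List.map_map]
    rfl
  have hofFn : List.ofFn (fun j : Fin (2 * n) => B' j) = (List.range (2 * n)).map B' := by
    rw [List.ofFn_eq_map, ← List.map_coe_finRange_eq_range, List.map_map]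
    rfl
  have htr : (List.ofFn (fun j : Fin (2 * n) => B' j)).prod.trace = (1 + Y * Yᴴ).det := by
    have hword : (List.ofFn (fun j : Fin (2 * n) => B' j)).prod = fockLift Y * (fockLift Y)ᴴ := by
      rw [hofFn, hsplit, ← hP, reflectionStep_conjTranspose_prod_range_map]
      congr 1 <;> refine congrArg List.prod (List.map_congr_left fun i hi => ?_) <;>
        rw [List.mem_range] at hi
      · simp only [hB', if_pos hi]
      · simp only [hB', if_neg (by omega : ¬ (n + i < n)), show 2 * n - 1 - (n + i) = n - 1 - i by omega]
    rw [hword, ← FockLiftPosDef.fockLift_conjTranspose, ← FockLiftPosDef.fockLift_mul,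
      FockLiftPosDef.trace_fockLift]
  -- the Schatten traces of the letters are the pure tiling terms
  set d : ℕ → ℝ := fun t => ((1 + ((T t)ᴴ * T t) ^ n).det).re with hd
  have hnu : ∀ i, ((B' i * (B' i)ᴴ) ^ n).trace.re = if i < n then d i else d (2 * n - 1 - i) := by
    intro i
    by_cases h : i < n
    · simp only [hB', hX, if_pos h, hd]
      rw [← FockLiftPosDef.fockLift_conjTranspose, ← FockLiftPosDef.fockLift_mul,
        ← StaticSliceBound.fockLift_pow, FockLiftPosDef.trace_fockLift, det_one_add_pow_comm]
    · simp only [hB', hX, if_neg h, hd, conjTranspose_conjTranspose]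
      rw [← FockLiftPosDef.fockLift_conjTranspose, ← FockLiftPosDef.fockLift_mul,
        ← StaticSliceBound.fockLift_pow, FockLiftPosDef.trace_fockLift]
  have hrhs : ∏ j : Fin (2 * n), ((B' j * (B' j)ᴴ) ^ n).trace.re = (∏ t ∈ Finset.range n, d t) ^ 2 := by
    rw [show (∏ j : Fin (2 * n), ((B' j * (B' j)ᴴ) ^ n).trace.re) =
        ∏ i ∈ Finset.range (2 * n), ((B' i * (B' i)ᴴ) ^ n).trace.re from
      Fin.prod_univ_eq_prod_range (fun i => ((B' i * (B' i)ᴴ) ^ n).trace.re) (2 * n),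
      two_mul, Finset.prod_range_add, sq]
    congr 1
    · exact Finset.prod_congr rfl fun i hi => by
        rw [Finset.mem_range] at hi
        rw [hnu i, if_pos hi]
    · rw [← Finset.prod_range_reflect d n]
      exact Finset.prod_congr rfl fun i hi => by
        rw [Finset.mem_range] at hi
        rw [hnu (n + i), if_neg (by omega), show 2 * n - 1 - (n + i) = n - 1 - i by omega]
  -- positivity bookkeeping and extraction of the square root
  have hdpos : ∀ t, 0 ≤ d t := fun t =>
    zero_le_one.trans (norm_det_one_add_psd ((posSemidef_conjTranspose_mul_self (T t)).pow n)).2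
  obtain ⟨hYn, hY1⟩ := norm_det_one_add_psd (posSemidef_self_mul_conjTranspose Y)
  rw [htr, hrhs, hYn, mul_comm 2 n, pow_mul,
    pow_le_pow_iff_left₀ (pow_nonneg (zero_le_one.trans hY1) n)
      (Finset.prod_nonneg fun t _ => hdpos t) two_ne_zero] at key
  exact key

end RouteBAlgebra

open RouteBAlgebra in
/-- **Helper `routeBPlusChain` (Route B, `+` half of the abstract chain of `routeBAlgebra`).** For positive
definite `M_i` and unitary `W_i` on `ZMod (2n+1)` (`n ≥ 1`):
`‖det (1 + word₊)‖ ^ n ≤ (∏ᵢ max(μᵢ(M_n), 1)) ^ n · ∏_{t<n} Re det (1 + (W_tᴴ M_t W_t M_{t+1})^n)`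
(realness of `det (1 + word₊)`, closed-slab packaging with defect removal, and the even-cycle chessboard estimate
on Fock space; module docstring). -/
theorem routeBPlusChain : ∀ {k : Type} [Fintype k] [DecidableEq k] (n : ℕ), 0 < n →
    ∀ (M : ZMod (2 * n + 1) → Matrix k k ℂ) (hM : ∀ i, (M i).PosDef)
      (W : ZMod (2 * n + 1) → Matrix k k ℂ), (∀ i, W i ∈ Matrix.unitaryGroup k ℂ) →
    ‖(1 + ((List.range (2 * n + 1)).map fun i : ℕ =>
        M ((fun j : ZMod (2 * n + 1) => if j.val ≤ n then j else -j) (i : ZMod (2 * n + 1))) *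
          (fun j : ZMod (2 * n + 1) => if j.val < n then W j else if j.val = n then 1 else (W (-1 - j))ᴴ)
            (i : ZMod (2 * n + 1))).prod).det‖ ^ n ≤
      (∏ i, max ((hM n).posSemidef.1.eigenvalues i) 1) ^ n *
        ∏ t : Fin n, ((1 + ((W t)ᴴ * M t * W t * M (t + 1)) ^ n).det).re := by
  intro k _ _ n hn M hM W hW
  obtain ⟨A, -, -, hre, htile⟩ := closedSlabPackaging n M hM W hW
  rw [← Complex.ofReal_prod, Complex.ofReal_re, ← norm_det_one_add_wordPlus n M W hM] at hre
  have hfock := fock_chessboard n hn (fun t : ℕ => (A t)ᴴ * W t * A (t + 1))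
  beta_reduce at hfock
  simp only [htile] at hfock
  have hp : (0 : ℝ) ≤ ∏ i, max ((hM n).posSemidef.1.eigenvalues i) 1 :=
    Finset.prod_nonneg fun i _ => zero_le_one.trans (le_max_right _ _)
  have h2 := pow_le_pow_left₀ (norm_nonneg _) hre n
  rw [mul_pow] at h2
  refine h2.trans ?_
  rw [Fin.prod_univ_eq_prod_range (fun t : ℕ => ((1 + ((W t)ᴴ * M t * W t * M (t + 1)) ^ n).det).re) n]
  exact mul_le_mul_of_nonneg_left hfock (pow_nonneg hp n)

end Summit.QuantumFields.QCD.Cruxes.CriticalLineDiamagnetism.ChessboardCellGain
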